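import Mathlib
import Summits.Ventures.DiscreteObjects.Mahler.SubLehmerDegreeTwelve
import Summits.Ventures.DiscreteObjects.Mahler.CensusKernelDeg12T
import Summits.Ventures.DiscreteObjects.Mahler.OddDegreeCensus

/-!
# Lehmer's conjecture for every integer polynomial of degree ≤ 13, in the kernel (venture `DiscreteObjects`, target L)

Cell `pub-namedobj`, seat `pub-namedobj-mahler-g12`. Framing: lottery ticket; floor = certified bounds/negative
ranges.

The degree-12 kernel census row `degreeCensus_twelve` (5 cores) added to `SubLehmerDegreeTwelve`:
* `minimalMeasure_degree_twelve` — an irreducible `P` of degree `12` with `M(P) > 1` has `M(P) ≥ M(mrwPoly12) = 1.2277…`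
  (MRW Table 1, `D = 12`, now a theorem for all integer polynomials of that degree, primitive or not);
* `lehmer_le_of_irreducible_of_natDegree_le_thirteen`, `lehmer_le_of_natDegree_le_thirteen` — every `P ∈ ℤ[X]` of
  degree `≤ 13` with `M(P) > 1` has `M(P) ≥ M(ℓ)`;
* `fourteen_le_natDegree_of_subLehmer` — `1 < M(P) < M(ℓ)` forces `deg P ≥ 14`.
CONTROL rows (published complete lists reach degree 44); kernel theorems with the standard axioms.
-/

namespace Summit.Ventures.DiscreteObjects.Mahler

open Polynomial Literature.NumberTheory.MahlerMeasure

/-- **Degree 12 (MRW Table 1, D = 12):** an irreducible `P` of degree `12` with `M(P) > 1` has `M(P) ≥ M(mrwPoly12)`. -/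
theorem minimalMeasure_degree_twelve {P : ℤ[X]} (hirr : Irreducible P) (hdeg : P.natDegree = 12)
    (h1 : 1 < intMahlerMeasure P) : intMahlerMeasure (mrwMinimalPoly 12) ≤ intMahlerMeasure P := by
  by_cases h : intMahlerMeasure P < 13 / 10
  · obtain ⟨l, hl, hform⟩ := degreeCensus_twelve P hdeg hirr h1 h
    rw [intMahlerMeasure_of_census_form hform]
    exact coresDeg12_min l hl
  · push Not at h
    have h12 : intMahlerMeasure (mrwMinimalPoly 12) ≤ intMahlerMeasure (ofCoeffs c12_01) := coresDeg12_min c12_01 (by simp [coresDeg12])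
    exact le_trans h12 (le_trans (le_of_lt (coresDeg12_measure_bounds c12_01 (by simp [coresDeg12])).2) h)

/-- An irreducible `P` of degree `12` with `M(P) > 1` has `M(P) > 1.1883 > M(ℓ)`. -/
theorem lehmer_lt_of_irreducible_degree_twelve {P : ℤ[X]} (hirr : Irreducible P) (hdeg : P.natDegree = 12)
    (h1 : 1 < intMahlerMeasure P) : intMahlerMeasure lehmerPoly < intMahlerMeasure P := by
  have hL : intMahlerMeasure lehmerPoly < 11883 / 10 ^ 4 := lt_trans lehmer_measure_upper_bound (by norm_num)
  by_cases h : intMahlerMeasure P < 13 / 10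
  · obtain ⟨l, hl, hform⟩ := degreeCensus_twelve P hdeg hirr h1 h
    rw [intMahlerMeasure_of_census_form hform]
    have hne : l ≠ c10_01 := by
      rintro rfl
      simp [coresDeg12, c10_01, c12_01, c12_02, c12_03, c12_04, c12_05] at hl
    exact lt_trans hL (census_le18_gap l (by simp [hl]) hne)
  · push Not at h
    exact lt_of_lt_of_le (lt_trans hL (by norm_num)) h

/-- **Irreducible polynomials of degree `≤ 13` satisfy Lehmer's bound.** -/
theorem lehmer_le_of_irreducible_of_natDegree_le_thirteen {P : ℤ[X]} (hirr : Irreducible P)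
    (hdeg : P.natDegree ≤ 13) (h1 : 1 < intMahlerMeasure P) :
    intMahlerMeasure lehmerPoly ≤ intMahlerMeasure P := by
  by_cases h11 : P.natDegree ≤ 11
  · exact lehmer_le_of_irreducible_of_natDegree_le_eleven hirr h11 h1
  by_cases h13 : 13 / 10 ≤ intMahlerMeasure P
  · exact le_trans (le_of_lt (lt_trans lehmer_measure_upper_bound (by norm_num))) h13
  push Not at h11 h13
  have hθ : intMahlerMeasure P < smythTheta := lt_trans h13 (lt_trans (by norm_num) smythTheta_gt)
  obtain ⟨-, ⟨j, hj⟩, -⟩ := reciprocal_of_measure_lt_smythTheta hirr h1 hθ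
  have hd : P.natDegree = 12 := by omega
  exact le_of_lt (lehmer_lt_of_irreducible_degree_twelve hirr hd h1)

/-- **Lehmer's conjecture holds for every integer polynomial of degree `≤ 13`:** `M(P) > 1 ⇒ M(P) ≥ M(ℓ)`. -/
theorem lehmer_le_of_natDegree_le_thirteen {p : ℤ[X]} (hdeg : p.natDegree ≤ 13) (h1 : 1 < intMahlerMeasure p) :
    intMahlerMeasure lehmerPoly ≤ intMahlerMeasure p := by
  classical
  have hp : p ≠ 0 := by
    intro h
    rw [h] at h1
    unfold intMahlerMeasure at h1
    rw [Polynomial.map_zero, mahlerMeasure_zero] at h1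
    linarith
  obtain ⟨u, hu⟩ := UniqueFactorizationMonoid.factors_prod hp
  obtain ⟨c, hc, hcu⟩ := Polynomial.isUnit_iff.mp u.isUnit
  set F := UniqueFactorizationMonoid.factors p with hF
  have hFirr : ∀ f ∈ F, Irreducible f := fun f hf => UniqueFactorizationMonoid.irreducible_of_factor f hf
  have hMu : intMahlerMeasure (↑u : ℤ[X]) = 1 := by
    rw [← hcu, intMahlerMeasure_C]
    rcases Int.isUnit_iff.mp hc with h | h <;> simp [h]
  have hMp : intMahlerMeasure p = (F.map intMahlerMeasure).prod := by
    rw [← hu, intMahlerMeasure_mul, hMu, mul_one, intMahlerMeasure_multiset_prod]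
  have hdvd : ∀ f ∈ F, f ∣ p := fun f hf => (Multiset.dvd_prod hf).trans ⟨↑u, hu.symm⟩
  have hge1 : ∀ x ∈ F.map intMahlerMeasure, 1 ≤ x := by
    intro x hx
    obtain ⟨f, hf, rfl⟩ := Multiset.mem_map.mp hx
    exact one_le_intMahlerMeasure (hFirr f hf).ne_zero
  have hprod_ge : ∀ x ∈ F.map intMahlerMeasure, x ≤ (F.map intMahlerMeasure).prod := by
    intro x hx
    obtain ⟨T, hT⟩ := Multiset.exists_cons_of_mem hx
    rw [hT, Multiset.prod_cons]
    have hT1 : 1 ≤ T.prod :=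
      Multiset.one_le_prod (fun y hy => hge1 y (by rw [hT]; exact Multiset.mem_cons_of_mem hy))
    have hx0 : 0 ≤ x := le_trans zero_le_one (hge1 x hx)
    nlinarith
  by_contra hlt
  push Not at hlt
  have hall : ∀ x ∈ F.map intMahlerMeasure, x = 1 := by
    intro x hx
    obtain ⟨f, hf, rfl⟩ := Multiset.mem_map.mp hx
    by_contra hne
    have hgt : 1 < intMahlerMeasure f := lt_of_le_of_ne (hge1 _ hx) (Ne.symm hne)
    have hfdeg : f.natDegree ≤ 13 := (natDegree_le_of_dvd (hdvd f hf) hp).trans hdeg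
    have h2 := lehmer_le_of_irreducible_of_natDegree_le_thirteen (hFirr f hf) hfdeg hgt
    have h3 := hprod_ge _ hx
    rw [← hMp] at h3
    linarith
  have : (F.map intMahlerMeasure).prod = 1 := Multiset.prod_eq_one hall
  rw [← hMp] at this
  linarith

/-- **A sub-Lehmer polynomial has degree at least `14`.** -/
theorem fourteen_le_natDegree_of_subLehmer {P : ℤ[X]} (hP : SubLehmer P) : 14 ≤ P.natDegree := by
  by_contra h
  push Not at h
  have := lehmer_le_of_natDegree_le_thirteen (p := P) (by omega) hP.1
  exact absurd hP.2 (not_lt.mpr this)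

/-- Census rows in the engines' format, degrees `≤ 13`, below Lehmer's measure: nothing. -/
theorem heightBoundedCensus_subLehmer_of_le_thirteen {n h : ℕ} (hn : n ≤ 13) :
    HeightBoundedCensus n h (intMahlerMeasure lehmerPoly) [] := by
  refine ⟨fun p hdeg _ h1 h2 => ?_, fun l hl => by simp at hl⟩
  exfalso
  have := lehmer_le_of_natDegree_le_thirteen (p := p) (by omega) h1
  linarith

/-- `DegreeCensus` is monotone in the bound: a census valid below `B'` is valid below any `B ≤ B'`. -/
theorem degreeCensus_mono {n : ℕ} {B B' : ℝ} {L : List (List ℤ)} (h : B ≤ B') (hc : DegreeCensus n B' L) :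
    DegreeCensus n B L :=
  fun p hdeg hirr h1 h2 => hc p hdeg hirr h1 (lt_of_lt_of_le h2 h)

/-- **The kernel census of small Mahler measures, degrees `1 … 13`, bound `13/10`:** the only irreducible integer
polynomials of degree `n ∈ [1, 13]` with `1 < M < 1.3` are, up to `±x`, the listed cores of degrees `8` (one), `10` (seven)
and `12` (five); every other degree `≤ 13` has none. All rows are theorems of the kernel (degrees `≤ 5` and odd degrees:
Smyth's theorem, gens 8–10; degrees `6, 8, 10, 12`: the kernel census of this seat). -/
theorem kernelCensus_le_thirteen :
    DegreeCensus 8 (13 / 10) coresDeg8 ∧ DegreeCensus 10 (13 / 10) coresDeg10 ∧ DegreeCensus 12 (13 / 10) coresDeg12 ∧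
      ∀ n : ℕ, 1 ≤ n → n ≤ 13 → n ≠ 8 → n ≠ 10 → n ≠ 12 → DegreeCensus n (13 / 10) [] := by
  refine ⟨degreeCensus_eight, degreeCensus_ten, degreeCensus_twelve, ?_⟩
  intro n hn1 hn13 h8 h10 h12
  have hθ : (13 : ℝ) / 10 ≤ smythTheta := le_of_lt (lt_trans (by norm_num) smythTheta_gt)
  rcases Nat.even_or_odd n with he | ho
  · have hφ : (13 : ℝ) / 10 ≤ (1 + Real.sqrt 5) / 2 := by
      have : (2 : ℝ) < Real.sqrt 5 := by
        rw [show (2 : ℝ) = Real.sqrt (2 ^ 2) by rw [Real.sqrt_sq (by norm_num)]]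
        exact Real.sqrt_lt_sqrt (by norm_num) (by norm_num)
      linarith
    obtain ⟨k, rfl⟩ := he
    rcases (by omega : k = 1 ∨ k = 2 ∨ k = 3) with rfl | rfl | rfl
    · exact degreeCensus_two_empty hφ
    · exact degreeCensus_mono (by norm_num) degreeCensus_four
    · exact degreeCensus_six
  · exact degreeCensus_odd_smythTheta ho hθ

end Summit.Ventures.DiscreteObjects.Mahler
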